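import Mathlib
import Summits.NavierStokesRegularity.NavierStokesRegularity.Theorems.EulerZoomLiouvillePowerGaugeEulerLiouvilleAffineTimePast
import HarnessLib

/-!
# Crux `EulerZoomLiouville.PowerGaugeEulerLiouville` (stmt-NavierStokesRegularity-19832), stub `stub_nonSelfSimilarRest`:
# members that are a steady field plus a SUPER-CRITICALLY MODULATED fixed field on a past slab are trivial

Helper file (theorems only; `--supports stmt-NavierStokesRegularity-19832`; def-free).  Hand leafhand-ns-eulerzoomliouville-11 g0;
second sequel to `…AffineTimePast`.

THE STRATUM.  A member `(u, p, H, c)` of Seregin's power-gauged class (`ρ > 0`) of the form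
`u(τ, x) = U₀(x) + θ(τ) U₁(x)` for a.e. `(τ, x) ∈ (−∞, T₁) × ℝ³`, some `T₁ ≤ 0`, `U₀, U₁ : ℝ³ → ℝ³` ARBITRARY and `θ : ℝ → ℝ` an
ARBITRARY scalar modulation (no measurability, monotonicity or sign condition) which is SUPER-CRITICAL in the far past,
`|θ(τ)| / |τ|^{(1−2ρ)/4} → ∞` as `τ → −∞`, vanishes a.e. on the whole slab (`ModulatedPast.ae_eq_zero_of_gauge_of_aeModulatedPast`,
binder form `Birth.nonSelfSimilar_of_aeModulatedPast` in the window `0 < ρ ≤ ½` of the open stubs).  Examples: `θ(τ) = τ` (the affine stratum), `|τ|^β` and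
`|τ|^β (2 + sin τ)` for `β > (1−2ρ)/4` — in particular every `β ≥ ¼` for every `ρ > 0` —, `e^{−τ}`.  The exponent `(1−2ρ)/4` is the one at
which the `A`-gauge growth `∫_{B_a}|u(s)|² ≤ c a^{1−2ρ}` on the window `s ∈ (−a², 0)` stops seeing the modulated part.

PROOF.  Fix one good slice `τ₂ ∈ (T₁ − 1, T₁)`.  For `M → ∞` choose `a` so large that `|θ(τ₁)| ≥ M|τ₁|^{(1−2ρ)/4}` on
`(−a², −a²/2)` and pick a good `τ₁` there; then `|θ(τ₁) − θ(τ₂)|² ≥ (M²/8) a^{1−2ρ}` while the two-slice estimate of `…AffineTimePast`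
gives `|θ(τ₁) − θ(τ₂)|² ∫_{B_a}|U₁|² ≤ 4 c a^{1−2ρ}`: `∫_{B_R}|U₁|² ≤ 32 c / M²` for every `R`, so `U₁ = 0` a.e. and the member is a.e.
steady in the past (`AePastSteady`).  (For `ρ > ½` the whole class is trivial by the tree's rung `powerGaugeEulerLiouville_largeRho`;
the binder form is stated in the window `0 < ρ ≤ ½` of `stub_nonSelfSimilarRest`, so that this file stays outside the Theses cone.)

WHAT THIS IS NOT: not a proof of the stub or of the crux; nothing about Navier–Stokes. [folklore]
-/

noncomputable section

-- flat `Theorems/<Route><Decl>…` files of one crux share the namespace of the crux (tree convention)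
set_option linter.dupNamespace false

open MeasureTheory Set Filter Topology Metric Function TopologicalSpace
open scoped RealInnerProductSpace NNReal ENNReal

namespace Summit.NavierStokesRegularity.NavierStokesRegularity.Theorems.PowerGaugeEulerLiouville

open Literature.Analysis Literature.Analysis.FunctionSpaces Literature.Analysis.FluidPDE

namespace ModulatedPast

/-- Real arithmetic of the critical exponent: for `s ≤ 1`, `a > 0` we have `a^{2s} / 2 ≤ (a²/2)^s`. [folklore] -/
theorem half_rpow_le {a s : ℝ} (ha : 0 < a) (hs1 : s ≤ 1) :
    a ^ (2 * s) / 2 ≤ (a ^ 2 / 2) ^ s := by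
  rw [Real.div_rpow (by positivity) (by norm_num), ← Real.rpow_natCast a 2, ← Real.rpow_mul ha.le]
  push_cast
  have h2 : (2 : ℝ) ^ s ≤ 2 := by
    calc (2 : ℝ) ^ s ≤ (2 : ℝ) ^ (1 : ℝ) := Real.rpow_le_rpow_of_exponent_le (by norm_num) hs1
      _ = 2 := Real.rpow_one 2
  have hpos : 0 < (2 : ℝ) ^ s := by positivity
  have hnum : 0 ≤ a ^ ((2 : ℝ) * s) := by positivity
  rw [div_le_div_iff₀ (by norm_num) hpos]
  exact mul_le_mul_of_nonneg_left h2 hnum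

/-- Choice of the scale: some `a > 0` with `a ≥ R`, `a² ≥ 4(1 − T₁)` and `a² ≥ −2 τ_M`. [folklore] -/
theorem exists_scale (R T₁ τM : ℝ) (hR : 0 < R) (hT₁ : T₁ ≤ 0) :
    ∃ a : ℝ, 0 < a ∧ R ≤ a ∧ 4 * (1 - T₁) ≤ a ^ 2 ∧ -2 * τM ≤ a ^ 2 := by
  have hTM : 0 ≤ |τM| := abs_nonneg _
  have hneg : -τM ≤ |τM| := neg_le_abs τM
  refine ⟨R + 2 * (1 - T₁) + 2 * |τM| + 1, by linarith, by linarith, ?_, ?_⟩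
  · have hw : 2 * (1 - T₁) ≤ R + 2 * (1 - T₁) + 2 * |τM| + 1 := by linarith
    have h2 : 2 ≤ R + 2 * (1 - T₁) + 2 * |τM| + 1 := by linarith
    calc 4 * (1 - T₁) = 2 * (1 - T₁) * 2 := by ring
      _ ≤ (R + 2 * (1 - T₁) + 2 * |τM| + 1) * (R + 2 * (1 - T₁) + 2 * |τM| + 1) :=
          mul_le_mul hw h2 (by norm_num) (by linarith)
      _ = (R + 2 * (1 - T₁) + 2 * |τM| + 1) ^ 2 := (sq _).symm
  · have h1 : 1 ≤ R + 2 * (1 - T₁) + 2 * |τM| + 1 := by linarith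
    have h2 : R + 2 * (1 - T₁) + 2 * |τM| + 1 ≤ (R + 2 * (1 - T₁) + 2 * |τM| + 1) ^ 2 := by
      rw [sq]; exact le_mul_of_one_le_right (by linarith) h1
    linarith

/-- The modulation gap in the far past: if `|θ₁| ≥ M |τ₁|^e` with `|τ₁| ≥ a²/2 ≥ 1`, `|θ₂| ≤ M/2`, `0 ≤ e`, `2e ≤ 1`, then
`(M²/8) a^{2(2e)} ≤ (θ₂ − θ₁)²`. [folklore] -/
theorem gap_sq_lower {a e M τ₁ θ₁ θ₂ : ℝ} (ha : 0 < a) (he0 : 0 ≤ e) (he1 : 2 * e ≤ 1) (hM : 0 ≤ M)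
    (habs : a ^ 2 / 2 ≤ |τ₁|) (hone : 1 ≤ a ^ 2 / 2) (hθ₁ : M * |τ₁| ^ e ≤ |θ₁|) (hθ₂ : |θ₂| ≤ M / 2) :
    M ^ 2 / 8 * a ^ (2 * (2 * e)) ≤ (θ₂ - θ₁) ^ 2 := by
  have hpow1 : 1 ≤ |τ₁| ^ e := Real.one_le_rpow (le_trans hone habs) he0
  have hBle : |θ₂| ≤ M / 2 * |τ₁| ^ e := by
    calc |θ₂| ≤ M / 2 * 1 := by linarith
      _ ≤ M / 2 * |τ₁| ^ e := by gcongr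
  have hgap : M / 2 * |τ₁| ^ e ≤ |θ₁ - θ₂| := by
    have h1 : |θ₁| - |θ₂| ≤ |θ₁ - θ₂| := abs_sub_abs_le_abs_sub _ _
    linarith
  have h1 : (M / 2 * |τ₁| ^ e) ^ 2 ≤ |θ₁ - θ₂| ^ 2 := pow_le_pow_left₀ (by positivity) hgap 2
  have h2 : (M / 2 * |τ₁| ^ e) ^ 2 = M ^ 2 / 4 * |τ₁| ^ (2 * e) := by
    rw [mul_pow, ← Real.rpow_natCast (|τ₁| ^ e) 2, ← Real.rpow_mul (abs_nonneg _)]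
    push_cast
    ring_nf
  have h3 : (a ^ 2 / 2) ^ (2 * e) ≤ |τ₁| ^ (2 * e) := Real.rpow_le_rpow (by positivity) habs (by positivity)
  have h4 : a ^ (2 * (2 * e)) / 2 ≤ (a ^ 2 / 2) ^ (2 * e) := half_rpow_le ha he1
  have h6 : M ^ 2 / 4 * (a ^ (2 * (2 * e)) / 2) ≤ M ^ 2 / 4 * |τ₁| ^ (2 * e) :=
    mul_le_mul_of_nonneg_left (h4.trans h3) (by positivity)
  have h7 : |θ₁ - θ₂| ^ 2 = (θ₂ - θ₁) ^ 2 := by rw [sq_abs]; ring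
  rw [h2] at h1
  linarith

/-- Division step in `ℝ≥0∞`: `ofReal Y ≤ X`, `X · I ≤ 4 · ofReal K`, `Y > 0` give `I ≤ ofReal (4K/Y)`. [folklore] -/
theorem lintegral_le_of_gap {X I : ℝ≥0∞} {Y K : ℝ} (hY : 0 < Y) (hXY : ENNReal.ofReal Y ≤ X)
    (h : X * I ≤ 4 * ENNReal.ofReal K) : I ≤ ENNReal.ofReal (4 * K / Y) := by
  have hpos : ENNReal.ofReal Y ≠ 0 := by rw [ENNReal.ofReal_ne_zero_iff]; exact hY
  have h1 : ENNReal.ofReal Y * I ≤ 4 * ENNReal.ofReal K := le_trans (mul_le_mul' hXY le_rfl) h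
  have h2 : I ≤ (ENNReal.ofReal Y)⁻¹ * (4 * ENNReal.ofReal K) := by
    rw [← ENNReal.div_eq_inv_mul]
    exact ENNReal.le_div_iff_mul_le (Or.inl hpos) (Or.inl ENNReal.ofReal_ne_top) |>.2 (by rwa [mul_comm])
  refine le_trans h2 (le_of_eq ?_)
  rw [← ENNReal.ofReal_inv_of_pos hY, ← ENNReal.ofReal_ofNat, ← ENNReal.ofReal_mul (by norm_num),
    ← ENNReal.ofReal_mul (by positivity)]
  congr 1
  field_simp

/-- **MEMBERS `U₀(x) + θ(τ) U₁(x)` WITH SUPER-CRITICAL MODULATION ARE TRIVIAL** (`0 < ρ ≤ ½`).  Let `(u, p)` be a suitable weak Euler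
pair on `(−∞,0) × ℝ³` with weak spatial gradient `H` and gauges `a^{2ρ} A(a) + a^{ρ} E(a) + a^{2ρ} D(a) ≤ c`, and suppose
`u(τ, x) = U₀(x) + θ(τ) U₁(x)` for a.e. `(τ, x) ∈ (−∞, T₁) × ℝ³`, some `T₁ ≤ 0`, `U₀ U₁ : ℝ³ → ℝ³` and `θ : ℝ → ℝ` arbitrary with
`|θ(τ)| / |τ|^{(1−2ρ)/4} → ∞` as `τ → −∞`.  Then `u = 0` a.e. on the slab. [folklore] -/
theorem ae_eq_zero_of_gauge_of_aeModulatedPast {ρ : ℝ} (hρ : 0 < ρ) (hρh : ρ ≤ 1 / 2)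
    {u : ℝ → EuclideanSpace ℝ (Fin 3) → EuclideanSpace ℝ (Fin 3)} {p : ℝ → EuclideanSpace ℝ (Fin 3) → ℝ}
    {H : ℝ → EuclideanSpace ℝ (Fin 3) → EuclideanSpace ℝ (Fin 3) →L[ℝ] EuclideanSpace ℝ (Fin 3)} {c : ℝ≥0}
    (hsw : IsSuitableWeakSolutionOn (slab (EuclideanSpace ℝ (Fin 3)) (Iio 0) isOpen_Iio) 0 0 u p)
    (hH : HasWeakSpatialGradientOn (slab (EuclideanSpace ℝ (Fin 3)) (Iio 0) isOpen_Iio) u H)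
    (hc : ∀ a : ℝ, 0 < a → ENNReal.ofReal (a ^ (2 * ρ)) * cknA a (0 : ℝ × EuclideanSpace ℝ (Fin 3)) u +
        ENNReal.ofReal (a ^ ρ) * cknE a (0 : ℝ × EuclideanSpace ℝ (Fin 3)) H +
        ENNReal.ofReal (a ^ (2 * ρ)) * cknD a (0 : ℝ × EuclideanSpace ℝ (Fin 3)) p ≤ (c : ℝ≥0∞))
    {T₁ : ℝ} (hT₁ : T₁ ≤ 0) {θ : ℝ → ℝ} {U₀ U₁ : EuclideanSpace ℝ (Fin 3) → EuclideanSpace ℝ (Fin 3)}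
    (hθ : Tendsto (fun τ : ℝ => |θ τ| / |τ| ^ ((1 - 2 * ρ) / 4)) atBot atTop)
    (hU : ∀ᵐ z ∂(volume.restrict (Iio T₁ ×ˢ (univ : Set (EuclideanSpace ℝ (Fin 3))))),
      u z.1 z.2 = U₀ z.2 + θ z.1 • U₁ z.2) :
    uncurry u =ᵐ[volume.restrict (Iio (0 : ℝ) ×ˢ (univ : Set (EuclideanSpace ℝ (Fin 3))))] 0 := by
  set e : ℝ := (1 - 2 * ρ) / 4 with he
  have he0 : 0 ≤ e := by rw [he]; linarith
  have he1 : 2 * e ≤ 1 := by rw [he]; linarith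
  -- (1) good slices
  have hgood : ∀ᵐ τ ∂(volume.restrict (Iio T₁)),
      LocallyIntegrable (u τ) volume ∧ ∀ᵐ x ∂(volume : Measure (EuclideanSpace ℝ (Fin 3))), u τ x = U₀ x + θ τ • U₁ x := by
    filter_upwards [FrameSteady.ae_hasWeakFDerivOn_slice_past hH hT₁,
      AffinePast.ae_ae_of_ae_slab (P := fun τ x => u τ x = U₀ x + θ τ • U₁ x) hU] with τ hτ hτ'
    exact ⟨locallyIntegrableOn_univ.1 (by simpa only [Opens.coe_top] using hτ.locallyIntegrableOn), hτ'⟩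
  have hA : ∀ a : ℝ, 0 < a →
      ENNReal.ofReal (a ^ (2 * ρ)) * cknA a (0 : ℝ × EuclideanSpace ℝ (Fin 3)) u ≤ (c : ℝ≥0∞) :=
    fun a ha => le_trans (le_add_right (le_add_right le_rfl)) (hc a ha)
  -- (2) one good reference slice `τ₂ ∈ (T₁ − 1, T₁)`
  have hwin₂ : volume (Ioo (T₁ - 1) T₁) ≠ 0 := by
    rw [Real.volume_Ioo]; exact (ENNReal.ofReal_pos.2 (by linarith)).ne'
  obtain ⟨τ₂, hτ₂, hgood₂⟩ := Measure.exists_mem_of_measure_ne_zero_of_ae hwin₂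
    (ae_restrict_of_ae_restrict_of_subset (fun τ hτ => hτ.2) hgood)
  have hm₂ : AEStronglyMeasurable (fun x => U₀ x + θ τ₂ • U₁ x) volume :=
    hgood₂.1.aestronglyMeasurable.congr hgood₂.2
  set B : ℝ := |θ τ₂| with hB
  -- (3) for every `M ≥ 2B + 1` and every `R > 0`: `∫_{B_R} |U₁|² ≤ 32 c / M²`, and `U₁` is measurable
  have hstep : ∀ M : ℝ, 2 * B + 1 ≤ M → ∀ R : ℝ, 0 < R →
      AEStronglyMeasurable U₁ volume ∧
      ∫⁻ x in ball (0 : EuclideanSpace ℝ (Fin 3)) R, ‖U₁ x‖ₑ ^ 2 ≤ ENNReal.ofReal (32 * (c : ℝ) / M ^ 2) := by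
    intro M hM R hR
    have hMpos : 0 < M := by have : 0 ≤ B := abs_nonneg _; linarith
    -- far past where the modulation dominates: `|θ τ| ≥ M |τ|^e` for `τ ≤ τM`
    obtain ⟨τM, hτM⟩ := eventually_atBot.1 (tendsto_atTop.1 hθ M)
    -- the scale `a`
    obtain ⟨a, hapos, haR, ha1, haM⟩ := exists_scale R T₁ τM hR hT₁
    have ha2pos : 0 < a ^ 2 := by positivity
    -- a good far slice `τ₁ ∈ (−a², −a²/2)`
    have hwin₁ : volume (Ioo (-(a ^ 2)) (-(a ^ 2) / 2)) ≠ 0 := by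
      rw [Real.volume_Ioo]; exact (ENNReal.ofReal_pos.2 (by linarith)).ne'
    have hsub₁ : Ioo (-(a ^ 2)) (-(a ^ 2) / 2) ⊆ Iio T₁ := fun τ hτ => by
      simp only [mem_Iio]; have := hτ.2; linarith
    obtain ⟨τ₁, hτ₁, hgood₁⟩ :=
      Measure.exists_mem_of_measure_ne_zero_of_ae hwin₁ (ae_restrict_of_ae_restrict_of_subset hsub₁ hgood)
    have hm₁ : AEStronglyMeasurable (fun x => U₀ x + θ τ₁ • U₁ x) volume :=
      hgood₁.1.aestronglyMeasurable.congr hgood₁.2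
    -- size of the modulation gap
    have hτ₁neg : τ₁ < 0 := by have := hτ₁.2; linarith
    have habs₁ : a ^ 2 / 2 ≤ |τ₁| := by rw [abs_of_neg hτ₁neg]; have := hτ₁.2; linarith
    have hone : 1 ≤ a ^ 2 / 2 := by linarith
    have hτ₁M : τ₁ ≤ τM := by have := hτ₁.2; linarith
    have hθ₁ : M * |τ₁| ^ e ≤ |θ τ₁| := by
      have h := hτM τ₁ hτ₁M
      rwa [le_div_iff₀ (Real.rpow_pos_of_pos (by linarith) _)] at h
    have hθ₂ : |θ τ₂| ≤ M / 2 := by rw [← hB]; linarith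
    have hgap2 : M ^ 2 / 8 * a ^ (1 - 2 * ρ) ≤ (θ τ₂ - θ τ₁) ^ 2 := by
      have h5 : a ^ (2 * (2 * e)) = a ^ (1 - 2 * ρ) := by rw [he]; ring_nf
      rw [← h5]
      exact gap_sq_lower hapos he0 he1 hMpos.le habs₁ hone hθ₁ hθ₂
    -- slice bounds at the two good times and the two-slice estimate
    have hwinτ₁ : τ₁ ∈ Ioo (-(a ^ 2)) 0 := ⟨hτ₁.1, hτ₁neg⟩
    have hwinτ₂ : τ₂ ∈ Ioo (-(a ^ 2)) 0 := ⟨by have := hτ₂.1; linarith, lt_of_lt_of_le hτ₂.2 hT₁⟩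
    have hb₁ : ∫⁻ x in ball (0 : EuclideanSpace ℝ (Fin 3)) a, ‖U₀ x + θ τ₁ • U₁ x‖ₑ ^ 2 ≤
        ENNReal.ofReal ((c : ℝ) * a ^ (1 - 2 * ρ)) := by
      refine le_of_eq_of_le ?_ (Backward.lintegral_ball_le_of_gaugeA hapos (hA a hapos) hwinτ₁)
      refine lintegral_congr_ae (ae_restrict_of_ae ?_)
      filter_upwards [hgood₁.2] with x hx
      rw [hx]
    have hb₂ : ∫⁻ x in ball (0 : EuclideanSpace ℝ (Fin 3)) a, ‖U₀ x + θ τ₂ • U₁ x‖ₑ ^ 2 ≤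
        ENNReal.ofReal ((c : ℝ) * a ^ (1 - 2 * ρ)) := by
      refine le_of_eq_of_le ?_ (Backward.lintegral_ball_le_of_gaugeA hapos (hA a hapos) hwinτ₂)
      refine lintegral_congr_ae (ae_restrict_of_ae ?_)
      filter_upwards [hgood₂.2] with x hx
      rw [hx]
    have hYpos : 0 < M ^ 2 / 8 * a ^ (1 - 2 * ρ) := by
      have := Real.rpow_pos_of_pos hapos (1 - 2 * ρ); positivity
    have hne : θ τ₂ - θ τ₁ ≠ 0 := by
      intro h0
      rw [h0] at hgap2
      norm_num at hgap2
      linarith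
    have hU₁meas : AEStronglyMeasurable U₁ volume := by
      have eU : U₁ = (θ τ₂ - θ τ₁)⁻¹ • ((fun x => U₀ x + θ τ₂ • U₁ x) - fun x => U₀ x + θ τ₁ • U₁ x) := by
        funext x
        simp only [Pi.smul_apply, Pi.sub_apply]
        rw [add_sub_add_left_eq_sub, ← sub_smul, smul_smul, inv_mul_cancel₀ hne, one_smul]
      rw [eU]
      exact (hm₂.sub hm₁).const_smul _
    refine ⟨hU₁meas, ?_⟩
    have hkey := AffinePast.lintegral_coeff_le_of_two_slices
      (μ := volume.restrict (ball (0 : EuclideanSpace ℝ (Fin 3)) a)) hm₂.restrict hb₁ hb₂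
    -- divide by the gap
    have hgap' : ENNReal.ofReal (M ^ 2 / 8 * a ^ (1 - 2 * ρ)) ≤ ‖θ τ₂ - θ τ₁‖ₑ ^ 2 := by
      rw [Real.enorm_eq_ofReal_abs, ← ENNReal.ofReal_pow (abs_nonneg _), sq_abs]
      exact ENNReal.ofReal_le_ofReal hgap2
    have h2 := lintegral_le_of_gap hYpos hgap' hkey
    refine le_trans (lintegral_mono_set (ball_subset_ball haR)) (le_trans h2 (le_of_eq ?_))
    congr 1
    have hane : a ^ (1 - 2 * ρ) ≠ 0 := (Real.rpow_pos_of_pos hapos _).ne'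
    field_simp
    ring
  -- (4) `U₁ = 0` a.e.
  have hM₀ : 0 < 2 * B + 1 := by have : 0 ≤ B := abs_nonneg _; linarith
  have hU₁meas : AEStronglyMeasurable U₁ volume := (hstep (2 * B + 1) le_rfl 1 one_pos).1
  have hball : ∀ R : ℝ, 0 < R → ∫⁻ x in ball (0 : EuclideanSpace ℝ (Fin 3)) R, ‖U₁ x‖ₑ ^ 2 = 0 := by
    intro R hR
    refine nonpos_iff_eq_zero.1 ?_
    have hlim : Tendsto (fun M : ℝ => ENNReal.ofReal (32 * (c : ℝ) / M ^ 2)) atTop (𝓝 0) := by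
      rw [show (0 : ℝ≥0∞) = ENNReal.ofReal 0 by simp]
      exact ENNReal.tendsto_ofReal (Tendsto.div_atTop tendsto_const_nhds (tendsto_pow_atTop two_ne_zero))
    refine ge_of_tendsto hlim ?_
    filter_upwards [eventually_ge_atTop (2 * B + 1)] with M hM
    exact (hstep M hM R hR).2
  have hU₁zero : ∀ᵐ x ∂(volume : Measure (EuclideanSpace ℝ (Fin 3))), U₁ x = 0 := by
    have hballae : ∀ n : ℕ, ∀ᵐ x ∂(volume.restrict (ball (0 : EuclideanSpace ℝ (Fin 3)) ((n : ℝ) + 1))), U₁ x = 0 := by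
      intro n
      have h0 := hball ((n : ℝ) + 1) (by positivity)
      have h1 := (lintegral_eq_zero_iff' (hU₁meas.restrict.enorm.pow_const 2)).1 h0
      filter_upwards [h1] with x hx
      simpa using hx
    have h := (ae_restrict_iUnion_iff (μ := (volume : Measure (EuclideanSpace ℝ (Fin 3))))
      (fun n : ℕ => ball (0 : EuclideanSpace ℝ (Fin 3)) ((n : ℝ) + 1)) (fun x => U₁ x = 0)).2 hballae
    rwa [iUnion_ball_nat_succ, Measure.restrict_univ] at h
  -- (5) a.e. steady in the past
  have hU' : ∀ᵐ z ∂(volume.restrict (Iio T₁ ×ˢ (univ : Set (EuclideanSpace ℝ (Fin 3))))), u z.1 z.2 = U₀ z.2 := by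
    filter_upwards [hU, AffinePast.ae_slab_of_ae (T₁ := T₁) hU₁zero] with z hz hz0
    rw [hz, hz0, smul_zero, add_zero]
  exact AePastSteady.ae_eq_zero_of_gauge_of_aePastSteady hρ hsw hH hc hT₁ hU'

end ModulatedPast

/-! ## Binder language (`Birth.InClass`), window `0 < ρ ≤ ½` of `stub_nonSelfSimilarRest` -/

/-- **Binder language: STEADY FIELD + SUPER-CRITICALLY MODULATED FIELD ⇒ TRIVIAL** — `u(τ, x) = U₀(x) + θ(τ) U₁(x)` for a.e.
`(τ, x) ∈ (−∞,T₁) × ℝ³`, some `T₁ ≤ 0`, `U₀ U₁ : ℝ³ → ℝ³` and `θ : ℝ → ℝ` arbitrary with `|θ(τ)| / |τ|^{(1−2ρ)/4} → ∞` as `τ → −∞`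
(e.g. `θ = τ`, `|τ|^β` or `|τ|^β (2 + sin τ)` with `β > (1−2ρ)/4`, `e^{−τ}`) ⇒ `u = 0` a.e., in the window `0 < ρ ≤ ½` of the open stubs
(`ModulatedPast.ae_eq_zero_of_gauge_of_aeModulatedPast`; `ρ > ½` is the tree's rung `powerGaugeEulerLiouville_largeRho`). [folklore] -/
theorem Birth.nonSelfSimilar_of_aeModulatedPast :
    ∀ ρ : ℝ, 0 < ρ → ρ ≤ 1 / 2 →
      ∀ (u : ℝ → EuclideanSpace ℝ (Fin 3) → EuclideanSpace ℝ (Fin 3)) (p : ℝ → EuclideanSpace ℝ (Fin 3) → ℝ)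
        (H : ℝ → EuclideanSpace ℝ (Fin 3) → EuclideanSpace ℝ (Fin 3) →L[ℝ] EuclideanSpace ℝ (Fin 3)) (c : ℝ≥0),
        Birth.InClass ρ u p H c →
          (∃ T₁ : ℝ, T₁ ≤ 0 ∧ ∃ θ : ℝ → ℝ, ∃ U₀ U₁ : EuclideanSpace ℝ (Fin 3) → EuclideanSpace ℝ (Fin 3),
              Tendsto (fun τ : ℝ => |θ τ| / |τ| ^ ((1 - 2 * ρ) / 4)) atBot atTop ∧
              ∀ᵐ z ∂(volume.restrict (Iio T₁ ×ˢ (univ : Set (EuclideanSpace ℝ (Fin 3))))),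
                u z.1 z.2 = U₀ z.2 + θ z.1 • U₁ z.2) →
          uncurry u =ᵐ[volume.restrict (Iio (0 : ℝ) ×ˢ (univ : Set (EuclideanSpace ℝ (Fin 3))))] 0 := by
  intro ρ hρ hρh u p H c hcl h
  obtain ⟨T₁, hT₁, θ, U₀, U₁, hθ, hU⟩ := h
  exact ModulatedPast.ae_eq_zero_of_gauge_of_aeModulatedPast hρ hρh hcl.1 hcl.2.1 hcl.2.2 hT₁ hθ hU

end Summit.NavierStokesRegularity.NavierStokesRegularity.Theorems.PowerGaugeEulerLiouville

end
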